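import Summits.ValiantsHypothesis.ValiantsHypothesis.Theorems.KPlusLogSqLawTropicalBDockingLaw

/-!
# Route «KPlusLogSqLaw», crux `TropicalB` (stmt-ValiantsHypothesis-19771) — NO PARALLEL DOUBLE CONTACT between two single-token
# activations over a common base (sequel of `…TropicalBDockingLaw`)

HONEST FRAMING.  Helper toward the registered stubs `stub_tropThin` / `stub_tropFat` of `Cruxes/TropicalB/Lines/birth.lean` (crux
`Summit.ValiantsHypothesis.ValiantsHypothesis.Theses.KPlusLogSqLaw.TropicalB`, item stmt-ValiantsHypothesis-19771, route KPlusLogSqLaw;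
cell `pub-symmetroid`, seat val-sym-trop-p5 g25, refuter-adjacent lane, 2026-08-29; `--supports … --as helper`).  A STRUCTURE law about
unique optima (`IsDominant`) of an ARBITRARY dominance design; nothing here bounds `TropicalB`, and nothing bears on `WeakLifting`,
DoorA26 / DoorA34, `MatrixDescartes` (stmt-ValiantsHypothesis-18050) or VP ≠ VNP.

THE LAW (`Docking.no_parallel_double_contact`).  Let `P` be the unique optimum at `θP` and `Q` at `θQ > θP`, both SINGLE-TOKEN
ACTIVATIONS over a base term `B` (the exponents of `P` agree with those of `B` off one column `eP`, where the exponent goes up; likewise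
`Q` off `eQ`) — e.g. `B = M_S`, `P = M_{S+x}`, `Q = M_{S+y}` in a radix-2 odometer.  Write `ρ_X = σ_B⁻¹σ_X`; the deviation of `X` from
`B` is permuted by `ρ_X` (the exchange cycle `Z_X`).  A PARALLEL DOUBLE CONTACT of `Z_P` and `Z_Q` is a pair of complementary dockings:
disjoint `ρ_P`-arcs `A, A′` covering the deviation of `P`, disjoint `ρ_Q`-arcs `D, D′` covering that of `Q`, `A ∩ D = ∅ = A′ ∩ D′`,
the exit of `A` docking onto the terminal of `D` and the exit of `D` onto the terminal of `A`, and likewise for `A′, D′` (in cycle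
language: two common columns `c₀, c*` that are CONSECUTIVE common columns along both cycles — `A = [c₀, c*)` along `ρ_P`,
`D = [c*, c₀)` along `ρ_Q`, `A′, D′` the complementary arcs; e.g. any two such cycles with exactly two common columns, at neither of
which `P` and `Q` carry the same cell — a SHARED ARC between the two common columns is the degenerate case, and it does occur: in
the 6-cube s204 of `…TropicalBBinaryCounterSix`, over the state `{2}` the activations of tokens `1` and `4` have the common columns `{0,1}`
and the same cell `(0,1)` of class `2` at column `1`).  THEN THERE IS NONE
(non-degenerately: `Q ≠ P` at some column of `D` and `P ≠ Q` at some column of `A`).  Proof: by the docking lemma the two dockings are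
present terms `T₁ = (P on A, Q on D, B elsewhere)`, `T₂ = (P on A′, Q on D′, B elsewhere)` forming a column-wise rearrangement of
`(P, Q)`, so `slope P < slope T₁ < slope Q` (`Docking.slope_sandwich`); but `slope T₁ ∈ {s_B, s_P, s_Q, s_P + s_Q − s_B}` according as
`eP ∈ A`, `eQ ∈ D`.  READING (memo CONTACT-LAWS-g25.md): together with the sunflower law (activation cycles over a common base always
meet, `…TropicalBDisjointDeviations`) this says the contact of two single-token activation cycles is ONE stretch traversed oppositely, or a
braid with no parallel consecutive pair; it is the exchange-calculus form of the junction «hop identity» that kills pairwise-coupled bit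
networks with a cycle in the coupling graph (trop-p1 g28, located; `…TropicalBNoRigidFanout`).

[folklore ingredients (cycle surgery, lower hulls); the packaging is the cell's, no citation exists]
-/

set_option linter.dupNamespace false
set_option autoImplicit false

namespace Summit.ValiantsHypothesis.ValiantsHypothesis.Theorems.KPlusLogSqLaw

namespace Docking

open Summit.ValiantsHypothesis.ValiantsHypothesis.Theorems.MatrixDescartes.Negative
open Summit.ValiantsHypothesis.ValiantsHypothesis.Theorems.LacunarySymmetroidMatrixDescartes
open Finset
open scoped BigOperators

variable {m K : ℕ}

/-! ## 3. No parallel double contact between single-token activations over a common base -/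

section Contact

variable (d : Fin K → ℕ) (v ε : Fin m → Fin m → Fin K → ℤ)

/-- slope of a term whose exponents differ from a base term at one column only. [elementary] -/
theorem slope_eq_of_concentrated (B X : Equiv.Perm (Fin m) × (Fin m → Fin K)) (e : Fin m)
    (hc : ∀ i, i ≠ e → d (X.2 i) = d (B.2 i)) :
    TropicalCensus.slope d X = TropicalCensus.slope d B + ((d (X.2 e) : ℤ) - d (B.2 e)) := by
  unfold TropicalCensus.slope
  have h : ∀ i ∈ (univ : Finset (Fin m)),
      (d (X.2 i) : ℤ) = (d (B.2 i) : ℤ) + (if i = e then ((d (X.2 e) : ℤ) - d (B.2 e)) else 0) := by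
    intro i _
    by_cases hi : i = e
    · subst hi; simp
    · rw [if_neg hi, hc i hi]; ring
  rw [sum_congr rfl h, sum_add_distrib, sum_ite_eq' univ e, if_pos (mem_univ e)]

set_option maxHeartbeats 400000 in
/-- **NO PARALLEL DOUBLE CONTACT.**  Let `P` be the unique optimum at `θP` and `Q` at `θQ > θP`, both SINGLE-TOKEN ACTIVATIONS over a
present base term `B`: the exponents of `P` agree with those of `B` off one column `eP`, where the exponent goes up, and likewise `Q`
off `eQ`.  Suppose the deviation of `P` from `B` is covered by two disjoint `ρ_P`-arcs `A, A′` and that of `Q` by two disjoint `ρ_Q`-arcs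
`D, D′` (`ρ_X = σ_B⁻¹ σ_X`), with `A ∩ D = ∅ = A′ ∩ D′`, such that `A` docks onto `D` and `D` onto `A` (exit of `A` ↦ terminal of `D`,
exit of `D` ↦ terminal of `A`) and likewise `A′`, `D′` — the PARALLEL DOUBLE CONTACT of the two exchange cycles (two common columns
consecutive along both) — non-degenerately (`Q ≠ P` at some column of `D`, `P ≠ Q` at some column of `A`).  Then: contradiction.
Proof: the two dockings are a column-wise rearrangement `(T₁, T₂)` of `(P, Q)` (`docking`), so `slope P < slope T₁ < slope Q`
(`slope_sandwich`); but `slope T₁ ∈ {s_B, s_P, s_Q, s_P + s_Q − s_B}`. [this cell; folklore ingredients] -/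
theorem no_parallel_double_contact {θP θQ : ℤ} {B P Q : Equiv.Perm (Fin m) × (Fin m → Fin K)}
    (hP : IsDominant d v ε θP P) (hQ : IsDominant d v ε θQ Q) (hθ : θP < θQ)
    (eP eQ : Fin m) (hcP : ∀ i, i ≠ eP → d (P.2 i) = d (B.2 i)) (hcQ : ∀ i, i ≠ eQ → d (Q.2 i) = d (B.2 i))
    (hδP : d (B.2 eP) < d (P.2 eP))
    (A D A' D' : Finset (Fin m)) (xA tA xD tD xA' tA' xD' tD' : Fin m)
    (hAD : Disjoint A D) (hAD' : Disjoint A' D') (hAA' : Disjoint A A') (hDD' : Disjoint D D')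
    (hcovP : ∀ i, i ∉ A → i ∉ A' → P.1 i = B.1 i ∧ P.2 i = B.2 i)
    (hcovQ : ∀ i, i ∉ D → i ∉ D' → Q.1 i = B.1 i ∧ Q.2 i = B.2 i)
    (htA : tA ∈ A) (htD : tD ∈ D) (htA' : tA' ∈ A') (htD' : tD' ∈ D')
    (hinA : ∀ i ∈ A, i ≠ xA → B.1.symm (P.1 i) ∈ A ∧ B.1.symm (P.1 i) ≠ tA)
    (hinD : ∀ i ∈ D, i ≠ xD → B.1.symm (Q.1 i) ∈ D ∧ B.1.symm (Q.1 i) ≠ tD)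
    (hinA' : ∀ i ∈ A', i ≠ xA' → B.1.symm (P.1 i) ∈ A' ∧ B.1.symm (P.1 i) ≠ tA')
    (hinD' : ∀ i ∈ D', i ≠ xD' → B.1.symm (Q.1 i) ∈ D' ∧ B.1.symm (Q.1 i) ≠ tD')
    (hxA : B.1.symm (P.1 xA) = tD) (hxD : B.1.symm (Q.1 xD) = tA)
    (hxA' : B.1.symm (P.1 xA') = tD') (hxD' : B.1.symm (Q.1 xD') = tA')
    (hndP : ∃ i ∈ D, ¬ (Q.1 i = P.1 i ∧ Q.2 i = P.2 i)) (hndQ : ∃ i ∈ A, ¬ (P.1 i = Q.1 i ∧ P.2 i = Q.2 i)) : False := by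
  classical
  -- the two dockings, as instances of the docking lemma over the index type `Bool` (`true` = the `P`-arc)
  let PQ : Bool → Equiv.Perm (Fin m) × (Fin m → Fin K) := fun b => if b then P else Q
  obtain ⟨T₁, hT₁in, hT₁out⟩ := docking (ι := Bool) B PQ (fun b => if b then A else D) (fun b => if b then xA else xD)
    (fun b => if b then tA else tD) (Equiv.swap true false)
    (by
      intro j j' hjj'
      cases j <;> cases j' <;> simp_all [disjoint_comm])
    (by intro j; cases j <;> simp [htA, htD])
    (by
      intro j i hi hix
      cases j
      · simp only [Bool.false_eq_true, ↓reduceIte] at hi hix ⊢; exact hinD i hi hix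
      · simp only [↓reduceIte] at hi hix ⊢; exact hinA i hi hix)
    (by
      intro j; cases j
      · simp only [Bool.false_eq_true, ↓reduceIte, Equiv.swap_apply_right]; exact hxD
      · simp only [↓reduceIte, Equiv.swap_apply_left, Bool.false_eq_true]; exact hxA)
  obtain ⟨T₂, hT₂in, hT₂out⟩ := docking (ι := Bool) B PQ (fun b => if b then A' else D') (fun b => if b then xA' else xD')
    (fun b => if b then tA' else tD') (Equiv.swap true false)
    (by
      intro j j' hjj'
      cases j <;> cases j' <;> simp_all [disjoint_comm])
    (by intro j; cases j <;> simp [htA', htD'])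
    (by
      intro j i hi hix
      cases j
      · simp only [Bool.false_eq_true, ↓reduceIte] at hi hix ⊢; exact hinD' i hi hix
      · simp only [↓reduceIte] at hi hix ⊢; exact hinA' i hi hix)
    (by
      intro j; cases j
      · simp only [Bool.false_eq_true, ↓reduceIte, Equiv.swap_apply_right]; exact hxD'
      · simp only [↓reduceIte, Equiv.swap_apply_left, Bool.false_eq_true]; exact hxA')
  -- unpack the block data
  have h1A : ∀ i ∈ A, T₁.1 i = P.1 i ∧ T₁.2 i = P.2 i := fun i hi => by simpa [PQ] using hT₁in true i (by simpa using hi)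
  have h1D : ∀ i ∈ D, T₁.1 i = Q.1 i ∧ T₁.2 i = Q.2 i := fun i hi => by simpa [PQ] using hT₁in false i (by simpa using hi)
  have h1B : ∀ i, i ∉ A → i ∉ D → T₁.1 i = B.1 i ∧ T₁.2 i = B.2 i :=
    fun i hA hD => hT₁out i (fun j => by cases j <;> simpa)
  have h2A : ∀ i ∈ A', T₂.1 i = P.1 i ∧ T₂.2 i = P.2 i := fun i hi => by simpa [PQ] using hT₂in true i (by simpa using hi)
  have h2D : ∀ i ∈ D', T₂.1 i = Q.1 i ∧ T₂.2 i = Q.2 i := fun i hi => by simpa [PQ] using hT₂in false i (by simpa using hi)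
  have h2B : ∀ i, i ∉ A' → i ∉ D' → T₂.1 i = B.1 i ∧ T₂.2 i = B.2 i :=
    fun i hA hD => hT₂out i (fun j => by cases j <;> simpa)
  -- the pair `(T₁, T₂)` is a column-wise rearrangement of `(P, Q)`
  have hre : ∀ i, (T₁.1 i = P.1 i ∧ T₁.2 i = P.2 i ∧ T₂.1 i = Q.1 i ∧ T₂.2 i = Q.2 i) ∨
      (T₁.1 i = Q.1 i ∧ T₁.2 i = Q.2 i ∧ T₂.1 i = P.1 i ∧ T₂.2 i = P.2 i) := by
    intro i
    by_cases hiA : i ∈ A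
    · have hiD : i ∉ D := disjoint_left.mp hAD hiA
      have hiA' : i ∉ A' := disjoint_left.mp hAA' hiA
      obtain ⟨e1, e2⟩ := h1A i hiA
      refine Or.inl ⟨e1, e2, ?_⟩
      by_cases hiD' : i ∈ D'
      · exact h2D i hiD'
      · obtain ⟨f1, f2⟩ := h2B i hiA' hiD'
        obtain ⟨g1, g2⟩ := hcovQ i hiD hiD'
        exact ⟨f1.trans g1.symm, f2.trans g2.symm⟩
    by_cases hiD : i ∈ D
    · have hiD' : i ∉ D' := disjoint_left.mp hDD' hiD
      obtain ⟨e1, e2⟩ := h1D i hiD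
      refine Or.inr ⟨e1, e2, ?_⟩
      by_cases hiA' : i ∈ A'
      · exact h2A i hiA'
      · obtain ⟨f1, f2⟩ := h2B i hiA' hiD'
        obtain ⟨g1, g2⟩ := hcovP i hiA hiA'
        exact ⟨f1.trans g1.symm, f2.trans g2.symm⟩
    obtain ⟨e1, e2⟩ := h1B i hiA hiD
    by_cases hiA' : i ∈ A'
    · have hiD' : i ∉ D' := disjoint_left.mp hAD' hiA'
      obtain ⟨g1, g2⟩ := hcovQ i hiD hiD'
      exact Or.inr ⟨e1.trans g1.symm, e2.trans g2.symm, h2A i hiA'⟩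
    · obtain ⟨g1, g2⟩ := hcovP i hiA hiA'
      refine Or.inl ⟨e1.trans g1.symm, e2.trans g2.symm, ?_⟩
      by_cases hiD' : i ∈ D'
      · exact h2D i hiD'
      · obtain ⟨f1, f2⟩ := h2B i hiA' hiD'
        obtain ⟨k1, k2⟩ := hcovQ i hiD hiD'
        exact ⟨f1.trans k1.symm, f2.trans k2.symm⟩
  -- non-degeneracy: `T₁ ∉ {P, Q}`
  have hT₁P : T₁ ≠ P := by
    obtain ⟨i, hiD, hne⟩ := hndP
    intro h
    obtain ⟨e1, e2⟩ := h1D i hiD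
    exact hne ⟨e1.symm.trans (by rw [h]), e2.symm.trans (by rw [h])⟩
  have hT₁Q : T₁ ≠ Q := by
    obtain ⟨i, hiA, hne⟩ := hndQ
    intro h
    obtain ⟨e1, e2⟩ := h1A i hiA
    exact hne ⟨e1.symm.trans (by rw [h]), e2.symm.trans (by rw [h])⟩
  obtain ⟨hlo, hhi⟩ := slope_sandwich d v ε hre hP hQ hθ hT₁P hT₁Q
  -- the slopes of `P`, `Q` relative to `B`
  have hsP := slope_eq_of_concentrated d B P eP hcP
  have hsQ := slope_eq_of_concentrated d B Q eQ hcQ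
  have hδP' : ((d (B.2 eP) : ℕ) : ℤ) < d (P.2 eP) := by exact_mod_cast hδP
  -- the slope of `T₁` in the four cases
  by_cases heA : eP ∈ A <;> by_cases heD : eQ ∈ D
  · -- both token columns inside: slope T₁ = slope P + slope Q − slope B
    have key : ∀ i ∈ (univ : Finset (Fin m)), (d (T₁.2 i) : ℤ) = (d (P.2 i) : ℤ) + d (Q.2 i) - d (B.2 i) := by
      intro i _
      by_cases hiA : i ∈ A
      · have hiQ : i ≠ eQ := fun h => disjoint_left.mp hAD hiA (h ▸ heD)
        rw [(h1A i hiA).2, hcQ i hiQ]; ring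
      by_cases hiD : i ∈ D
      · have hiP : i ≠ eP := fun h => hiA (h ▸ heA)
        rw [(h1D i hiD).2, hcP i hiP]; ring
      · have hiP : i ≠ eP := fun h => hiA (h ▸ heA)
        have hiQ : i ≠ eQ := fun h => hiD (h ▸ heD)
        rw [(h1B i hiA hiD).2, hcP i hiP, hcQ i hiQ]; ring
    have hs : TropicalCensus.slope d T₁ = TropicalCensus.slope d P + TropicalCensus.slope d Q - TropicalCensus.slope d B := by
      unfold TropicalCensus.slope
      rw [sum_congr rfl key, sum_sub_distrib, sum_add_distrib]
    linarith
  · -- only `eP` inside: slope T₁ = slope P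
    have key : ∀ i ∈ (univ : Finset (Fin m)), (d (T₁.2 i) : ℤ) = d (P.2 i) := by
      intro i _
      by_cases hiA : i ∈ A
      · rw [(h1A i hiA).2]
      by_cases hiD : i ∈ D
      · have hiP : i ≠ eP := fun h => hiA (h ▸ heA)
        have hiQ : i ≠ eQ := fun h => heD (h ▸ hiD)
        rw [(h1D i hiD).2, hcQ i hiQ, hcP i hiP]
      · have hiP : i ≠ eP := fun h => hiA (h ▸ heA)
        rw [(h1B i hiA hiD).2, hcP i hiP]
    have hs : TropicalCensus.slope d T₁ = TropicalCensus.slope d P := by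
      unfold TropicalCensus.slope; exact sum_congr rfl key
    linarith
  · -- only `eQ` inside: slope T₁ = slope Q
    have key : ∀ i ∈ (univ : Finset (Fin m)), (d (T₁.2 i) : ℤ) = d (Q.2 i) := by
      intro i _
      by_cases hiA : i ∈ A
      · have hiP : i ≠ eP := fun h => heA (h ▸ hiA)
        have hiQ : i ≠ eQ := fun h => disjoint_left.mp hAD hiA (h ▸ heD)
        rw [(h1A i hiA).2, hcP i hiP, hcQ i hiQ]
      by_cases hiD : i ∈ D
      · rw [(h1D i hiD).2]
      · have hiQ : i ≠ eQ := fun h => hiD (h ▸ heD)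
        rw [(h1B i hiA hiD).2, hcQ i hiQ]
    have hs : TropicalCensus.slope d T₁ = TropicalCensus.slope d Q := by
      unfold TropicalCensus.slope; exact sum_congr rfl key
    linarith
  · -- neither inside: slope T₁ = slope B
    have key : ∀ i ∈ (univ : Finset (Fin m)), (d (T₁.2 i) : ℤ) = d (B.2 i) := by
      intro i _
      by_cases hiA : i ∈ A
      · have hiP : i ≠ eP := fun h => heA (h ▸ hiA)
        rw [(h1A i hiA).2, hcP i hiP]
      by_cases hiD : i ∈ D
      · have hiQ : i ≠ eQ := fun h => heD (h ▸ hiD)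
        rw [(h1D i hiD).2, hcQ i hiQ]
      · rw [(h1B i hiA hiD).2]
    have hs : TropicalCensus.slope d T₁ = TropicalCensus.slope d B := by
      unfold TropicalCensus.slope; exact sum_congr rfl key
    linarith

end Contact

end Docking

end Summit.ValiantsHypothesis.ValiantsHypothesis.Theorems.KPlusLogSqLaw
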